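import Summits.AtomisticToContinuum.FouriersLaw.Theorems.CageBudgetFeketeHeatVarianceCalculusLaplace
import HarnessLib

/-!
# Stub `stub_abelOfIntegrableNegPart` of line `Sketch`
(crux `CoercivePulse.AbelRegularity`, item stmt-AtomisticToContinuum-15384; `--supports` file, closes nothing)

WHAT. The registered stub S3 of the crux's skeleton (`Cruxes/AbelRegularity/Lines/Sketch.lean`), a pure
real-analysis step: for a continuous `F : ℝ → ℝ` with `|F| ≤ M` whose negative part `F⁻ = max(−F, 0)` is
integrable on `(0, ∞)`, the Abel means `A(ν) = ∫₀^∞ e^{-νt} F(t) dt` either converge in `ℝ` or tend to `+∞`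
as `ν ↓ 0` (oscillation is excluded).

HOW. Split `F = F⁺ − F⁻` with `F⁺ = max(F, 0)`, `F⁻ = max(−F, 0)` (both continuous, bounded by `M`,
non-negative). For `ν > 0` both Laplace integrands are integrable
(`HeatVarianceCalculus.CanonicalRigidity.integrableOn_exp_neg_mul_of_abs_le_pow`), so `A = P − N` on `(0, ∞)` with
`P(ν) = ∫e^{-νt}F⁺`, `N(ν) = ∫e^{-νt}F⁻`. `N(ν) → ∫F⁻` as `ν ↓ 0` by dominated convergence (bound `F⁻ ∈ L¹`,
`0 < e^{-νt} ≤ 1`). `P` is antitone on `(0, ∞)` (`F⁺ ≥ 0` and `e^{-ν't} ≤ e^{-νt}` for `ν ≤ ν'`, `t > 0`), so along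
`𝓝[>] 0` it tends to `+∞` or to a finite limit (`tendsto_atBot_of_antitone` on the subtype `Ioi 0`, transported
by `tendsto_comp_coe_Ioi_atBot`). Hence `A = P − N` tends to `+∞` or converges. Mathlib only; no named fact used.
-/

noncomputable section

namespace Summit.AtomisticToContinuum.FouriersLaw.Theorems.AbelRegularity.Sketch

open MeasureTheory Filter Set Topology
open Summit.AtomisticToContinuum.FouriersLaw.Theorems.HeatVarianceCalculus.CanonicalRigidity
  (integrableOn_exp_neg_mul_of_abs_le_pow)

/-- **Laplace means of an integrable function converge to its integral at low frequency.** If `g` is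
integrable on `(0, ∞)` then `∫₀^∞ e^{−νt} g(t) dt → ∫₀^∞ g` as `ν ↓ 0`: dominated convergence with the bound
`|g|` (for `ν, t > 0`, `0 < e^{−νt} ≤ 1`) and the pointwise limit `e^{0} g(t) = g(t)`. [folklore] -/
theorem abelNegPart_tendsto_laplace_of_integrableOn {g : ℝ → ℝ} (hg : IntegrableOn g (Ioi 0)) :
    Tendsto (fun ν : ℝ => ∫ t in Ioi (0:ℝ), Real.exp (-(ν * t)) * g t) (𝓝[>] 0)
      (𝓝 (∫ t in Ioi (0:ℝ), g t)) := by
  have key : Tendsto (fun ν : ℝ => ∫ t in Ioi (0:ℝ), Real.exp (-(ν * t)) * g t) (𝓝[>] 0)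
      (𝓝 (∫ t in Ioi (0:ℝ), Real.exp (-(0 * t)) * g t)) := by
    refine tendsto_integral_filter_of_dominated_convergence (fun t => ‖g t‖) ?_ ?_ hg.norm ?_
    · exact Eventually.of_forall fun ν =>
        (Continuous.aestronglyMeasurable (by fun_prop)).mul hg.aestronglyMeasurable
    · filter_upwards [self_mem_nhdsWithin] with ν hν
      refine (ae_restrict_iff' measurableSet_Ioi).2 (Eventually.of_forall fun t ht => ?_)
      have hν0 : (0:ℝ) < ν := hν
      have ht0 : (0:ℝ) < t := ht
      have h1 : Real.exp (-(ν * t)) ≤ 1 := Real.exp_le_one_iff.2 (by nlinarith [mul_pos hν0 ht0])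
      rw [norm_mul, Real.norm_eq_abs, abs_of_pos (Real.exp_pos _)]
      exact mul_le_of_le_one_left (norm_nonneg _) h1
    · refine Eventually.of_forall fun t => tendsto_nhdsWithin_of_tendsto_nhds ?_
      have hcont : Continuous fun ν : ℝ => Real.exp (-(ν * t)) * g t := by fun_prop
      exact hcont.tendsto 0
  simpa using key

/-- **The Laplace means of a non-negative bounded continuous function are antitone in the frequency.** For
continuous `g` with `|g| ≤ M` and `g ≥ 0`, `ν ↦ ∫₀^∞ e^{−νt} g(t) dt` is antitone on `(0, ∞)`, since
`e^{−ν't} g(t) ≤ e^{−νt} g(t)` for `0 < ν ≤ ν'`, `t > 0`, both integrands being integrable. [folklore] -/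
theorem abelNegPart_antitoneOn_laplace {g : ℝ → ℝ} (hg : Continuous g) {M : ℝ} (hb : ∀ t : ℝ, |g t| ≤ M)
    (h0 : ∀ t : ℝ, 0 ≤ g t) :
    AntitoneOn (fun ν : ℝ => ∫ t in Ioi (0:ℝ), Real.exp (-(ν * t)) * g t) (Ioi 0) := by
  intro ν hν ν' hν' hle
  have hb' : ∀ t : ℝ, 0 ≤ t → |g t| ≤ M * t ^ 0 := fun t _ => by simpa using hb t
  refine setIntegral_mono_on (integrableOn_exp_neg_mul_of_abs_le_pow hg hb' hν')
    (integrableOn_exp_neg_mul_of_abs_le_pow hg hb' hν) measurableSet_Ioi fun t ht => ?_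
  refine mul_le_mul_of_nonneg_right (Real.exp_le_exp.2 (neg_le_neg ?_)) (h0 t)
  exact mul_le_mul_of_nonneg_right hle (le_of_lt ht)

/-- **One-sided limit of an antitone function at the left end of `(0, ∞)`.** If `P` is antitone on `(0, ∞)`
then along `𝓝[>] 0` it tends to `+∞` or to a finite limit (monotone convergence on the subtype `Ioi 0`,
`tendsto_atBot_of_antitone`, transported by `tendsto_comp_coe_Ioi_atBot`). [folklore] -/
theorem abelNegPart_dichotomy_of_antitoneOn {P : ℝ → ℝ} (hP : AntitoneOn P (Ioi 0)) :
    Tendsto P (𝓝[>] 0) atTop ∨ ∃ l : ℝ, Tendsto P (𝓝[>] 0) (𝓝 l) := by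
  have hA : Antitone (fun ν : Ioi (0:ℝ) => P ν) := fun x y hxy => hP x.2 y.2 hxy
  rcases tendsto_atBot_of_antitone hA with h | ⟨l, hl⟩
  · exact Or.inl ((tendsto_comp_coe_Ioi_atBot (a := (0:ℝ)) (f := P) (l := atTop)).1 h)
  · exact Or.inr ⟨l, (tendsto_comp_coe_Ioi_atBot (a := (0:ℝ)) (f := P) (l := 𝓝 l)).1 hl⟩

/-- **Abel dichotomy from a decomposition `F = F⁺ − F⁻` with integrable `F⁻`.** If `F = Fp − Fm` pointwise
with `Fp, Fm` continuous, `|Fp|, |Fm| ≤ M`, `Fp ≥ 0` and `Fm ∈ L¹(0, ∞)`, then the Abel means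
`∫₀^∞ e^{−νt} F(t) dt` converge in `ℝ` or tend to `+∞` as `ν ↓ 0`: `A = P − N` on `(0, ∞)` with `P` antitone
(`abelNegPart_antitoneOn_laplace`, `abelNegPart_dichotomy_of_antitoneOn`) and `N → ∫Fm`
(`abelNegPart_tendsto_laplace_of_integrableOn`). [folklore] -/
theorem abelNegPart_dichotomy_of_decomposition {F Fp Fm : ℝ → ℝ} {M : ℝ} (hFp : Continuous Fp)
    (hFm : Continuous Fm) (hbp : ∀ t : ℝ, |Fp t| ≤ M) (hbm : ∀ t : ℝ, |Fm t| ≤ M)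
    (h0p : ∀ t : ℝ, 0 ≤ Fp t) (hint : IntegrableOn Fm (Ioi 0)) (hsplit : ∀ t : ℝ, F t = Fp t - Fm t) :
    (∃ L : ℝ, Tendsto (fun ν : ℝ => ∫ t in Ioi (0:ℝ), Real.exp (-(ν * t)) * F t) (𝓝[>] 0) (𝓝 L)) ∨
      Tendsto (fun ν : ℝ => ∫ t in Ioi (0:ℝ), Real.exp (-(ν * t)) * F t) (𝓝[>] 0) atTop := by
  have hbp' : ∀ t : ℝ, 0 ≤ t → |Fp t| ≤ M * t ^ 0 := fun t _ => by simpa using hbp t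
  have hbm' : ∀ t : ℝ, 0 ≤ t → |Fm t| ≤ M * t ^ 0 := fun t _ => by simpa using hbm t
  -- `A = P - N` on `(0, ∞)`
  have hAeq : (fun ν : ℝ => (∫ t in Ioi (0:ℝ), Real.exp (-(ν * t)) * Fp t) -
      ∫ t in Ioi (0:ℝ), Real.exp (-(ν * t)) * Fm t) =ᶠ[𝓝[>] 0]
      fun ν : ℝ => ∫ t in Ioi (0:ℝ), Real.exp (-(ν * t)) * F t := by
    filter_upwards [self_mem_nhdsWithin] with ν hν
    rw [← integral_sub (integrableOn_exp_neg_mul_of_abs_le_pow hFp hbp' hν)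
      (integrableOn_exp_neg_mul_of_abs_le_pow hFm hbm' hν)]
    refine integral_congr_ae (Eventually.of_forall fun t => ?_)
    simp only [hsplit t, mul_sub]
  -- `N → ∫ Fm`
  have hN : Tendsto (fun ν : ℝ => ∫ t in Ioi (0:ℝ), Real.exp (-(ν * t)) * Fm t) (𝓝[>] 0)
      (𝓝 (∫ t in Ioi (0:ℝ), Fm t)) :=
    abelNegPart_tendsto_laplace_of_integrableOn hint
  -- `P` antitone: `+∞` or a finite limit
  rcases abelNegPart_dichotomy_of_antitoneOn (abelNegPart_antitoneOn_laplace hFp hbp h0p) with hTop | ⟨l, hl⟩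
  · right
    have h1 : Tendsto (fun ν : ℝ => (∫ t in Ioi (0:ℝ), Real.exp (-(ν * t)) * Fp t) -
        ∫ t in Ioi (0:ℝ), Real.exp (-(ν * t)) * Fm t) (𝓝[>] 0) atTop := by
      simpa only [sub_eq_add_neg] using hTop.atTop_add hN.neg
    exact h1.congr' hAeq
  · left
    exact ⟨l - ∫ t in Ioi (0:ℝ), Fm t, (hl.sub hN).congr' hAeq⟩

/-- **Stub S3 `stub_abelOfIntegrableNegPart` (registered signature, verbatim): integrable anticorrelation
gives the Abel dichotomy.** For continuous `F` with `|F| ≤ M` and `F⁻ = max(−F, 0) ∈ L¹(0, ∞)`, the Abel means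
`A[F](ν) = ∫₀^∞ e^{-νt} F(t) dt` converge in `ℝ` or tend to `+∞` as `ν ↓ 0`: `A = P − N` with
`P(ν) = ∫e^{-νt}F⁺` antitone in `ν` on `(0, ∞)` and `N(ν) = ∫e^{-νt}F⁻ → ∫F⁻` (dominated convergence).
[folklore] -/
theorem stub_abelOfIntegrableNegPart :
    ∀ (F : ℝ → ℝ) (M : ℝ), Continuous F → (∀ t : ℝ, |F t| ≤ M) → MeasureTheory.IntegrableOn (fun t : ℝ => max (-F t) 0) (Set.Ioi 0) → (∃ L : ℝ, Filter.Tendsto (fun ν : ℝ => ∫ t in Set.Ioi (0:ℝ), Real.exp (-(ν * t)) * F t) (nhdsWithin (0:ℝ) (Set.Ioi 0)) (nhds L)) ∨ Filter.Tendsto (fun ν : ℝ => ∫ t in Set.Ioi (0:ℝ), Real.exp (-(ν * t)) * F t) (nhdsWithin (0:ℝ) (Set.Ioi 0)) Filter.atTop := by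
  intro F M hF hM hneg
  have hM0 : 0 ≤ M := (abs_nonneg _).trans (hM 0)
  have hbp : ∀ t : ℝ, |max (F t) 0| ≤ M := fun t => by
    rw [abs_of_nonneg (le_max_right _ _)]
    exact max_le ((le_abs_self _).trans (hM t)) hM0
  have hbm : ∀ t : ℝ, |max (-F t) 0| ≤ M := fun t => by
    rw [abs_of_nonneg (le_max_right _ _)]
    exact max_le ((neg_le_abs _).trans (hM t)) hM0
  have hsplit : ∀ t : ℝ, F t = max (F t) 0 - max (-F t) 0 := fun t => by
    rcases le_total 0 (F t) with h | h
    · rw [max_eq_left h, max_eq_right (neg_nonpos.2 h), sub_zero]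
    · rw [max_eq_right h, max_eq_left (neg_nonneg.2 h), zero_sub, neg_neg]
  exact abelNegPart_dichotomy_of_decomposition (F := F) (Fp := fun t => max (F t) 0)
    (Fm := fun t => max (-F t) 0) (hF.max continuous_const) (hF.neg.max continuous_const) hbp hbm
    (fun t => le_max_right _ _) hneg hsplit

end Summit.AtomisticToContinuum.FouriersLaw.Theorems.AbelRegularity.Sketch

end
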